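import Mathlib
import Summits.Ventures.PercRepro2.ZMeanProof
import Summits.Ventures.PercRepro2.PendantRoot
import Summits.Ventures.PercRepro2.HMFLeaf
import Summits.Ventures.PercRepro2.DiagBA3
import Summits.Ventures.PercRepro2.HMFPendantBEvents

/-!
# (HMF) at a pendant `a₃` at the marker `b` reduces to one 4-mark inequality (ATT-b)
(blind cell PercRepro2, night-1 g6; exploration lens, NIGHT1-G6.md §9)

With `q = p f` and the star-free `Q`-masses of `G − a₃` (`Z = P(Q)`, `A_L = P(Q,oL)`, `B_H = P(Q,bH)`,
`x_LH = P(Q,bH,oL)`, …) the cleared mean field at a pendant `b` is a quadratic in `q`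
(`HMFc_pendant_b`):

  `HMFc = 2 q (1 − q) · attB + q² · Gc(o, a₁, a₂, b, b)`,

  `attB = (Z + B_L) s_LH + (Z + B_H) s_HL − B_H s_LL − B_L s_HH`

in the four BHK slacks `s_LL = Z x_LL − A_L B_L`, `s_HH`, `s_LH = A_L B_H − Z x_LH`, `s_HL` of the
`a₃`-free world (the `q = 1` endpoint is the diagonal `b = a₃`, where the mean field is exact).
Since `Gc(o, a₁, a₂, b, b) ≥ 0` (`DiagBA3.Gc_diag3_nonneg`), **`HMF_pendant_b`**: `0 ≤ attB` implies
(HMF) — and **`HCov_pendant_b`**: (HCOV) — at every pendant `a₃` at `b`.  (ATT-b), «the cross-cluster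
BHK slacks weighted by `Z + B` dominate the same-cluster slacks weighted by `B`», is the whole
residual of that attachment case (census 0 / 584 exact instances, NIGHT1-G6.md §9).
-/

namespace Summit.Ventures.PercRepro2

namespace HMFPendantB

open UnionCluster CovForm PendantRoot HMFPendantRoot

variable {V : Type*} {E : Type*} [Fintype E] [DecidableEq E] [Fintype V] [DecidableEq V]
  {R : Type*} [Field R] [LinearOrder R] [IsStrictOrderedRing R]

/-! ## The identity and the reduction -/

section Main

variable (p : E → R) (ends : E → Sym2 V) {f : E} {a₃ b : V}

omit [Fintype E] [DecidableEq E] in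
/-- The residual `Q` of the isolated leaf at `b` is `Q`. -/
lemma delQ_leaf_b (hf : ends f = s(a₃, b)) (hleaf : ∀ e, a₃ ∈ ends e → e = f) (h3b : a₃ ≠ b)
    {a₁ a₂ : V} (h31 : a₃ ≠ a₁) (h32 : a₃ ≠ a₂) :
    delQ ends ({a₃} : Finset V) a₁ a₂ = avoidAll ends a₂ {a₁} := by
  rw [delQ, connDelEvent_leaf hf hleaf h3b (Ne.symm h31) (Ne.symm h32), avoidAll_eq_compl]

/-- `P(Q) · termW({a₃}) = P(Q,oL) P(Q,bH) + P(Q,oH) P(Q,bL)` at a pendant `b`. -/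
lemma termW_leaf_b (hp : IsProbVec p) (hf : ends f = s(a₃, b)) (hleaf : ∀ e, a₃ ∈ ends e → e = f)
    (h3b : a₃ ≠ b) {o a₁ a₂ : V} (h31 : a₃ ≠ a₁) (h32 : a₃ ≠ a₂) (ho : o ≠ a₃) :
    prob p (avoidAll ends a₂ {a₁}) * termW p ends o a₁ a₂ b {a₃} =
      prob p (avoidAll ends a₂ {a₁} ∩ connEvent ends a₁ o) *
          prob p (avoidAll ends a₂ {a₁} ∩ connEvent ends a₂ b) +
        prob p (avoidAll ends a₂ {a₁} ∩ connEvent ends a₂ o) *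
          prob p (avoidAll ends a₂ {a₁} ∩ connEvent ends a₁ b) := by
  have h1 : a₁ ∉ ({a₃} : Finset V) := by simp [Ne.symm h31]
  have h2 : a₂ ∉ ({a₃} : Finset V) := by simp [Ne.symm h32]
  have ho' : o ∉ ({a₃} : Finset V) := by simp [ho]
  have hb' : b ∉ ({a₃} : Finset V) := by simp [Ne.symm h3b]
  simp only [termW, h1, h2, if_false, termPD, delShareMass, ho', hb',
    delQ_leaf_b ends hf hleaf h3b h31 h32, connDelEvent_leaf hf hleaf h3b (Ne.symm h31) ho,
    connDelEvent_leaf hf hleaf h3b (Ne.symm h32) (Ne.symm h3b),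
    connDelEvent_leaf hf hleaf h3b (Ne.symm h32) ho, connDelEvent_leaf hf hleaf h3b (Ne.symm h31) (Ne.symm h3b)]
  by_cases hZ : prob p (avoidAll ends a₂ {a₁}) = 0
  · have hmono : ∀ X, prob p (avoidAll ends a₂ {a₁} ∩ X) = 0 := fun X =>
      le_antisymm (by rw [← hZ]; exact prob_mono hp Set.inter_subset_left) (prob_nonneg hp _)
    simp [hZ, hmono]
  · rw [mul_div_cancel₀ _ hZ]

omit [Fintype E] [DecidableEq E] [Fintype V] [DecidableEq V] [LinearOrder R] [IsStrictOrderedRing R] in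
/-- The first `X̂`-atom: `{b ↔ a₂, a₁ ↔ o, b ↮ a₁} = Q ∩ {b ∈ C₂} ∩ {o ∈ C₁}`. -/
lemma atom_bH_oL (a₁ a₂ o : V) :
    connEvent ends b a₂ ∩ connEvent ends a₁ o ∩ (connEvent ends b a₁)ᶜ =
      avoidAll ends a₂ {a₁} ∩ connEvent ends a₂ b ∩ connEvent ends a₁ o := by
  rw [avoidAll_eq_compl]
  ext ω
  simp only [Set.mem_inter_iff, Set.mem_compl_iff, connEvent, Set.mem_setOf_eq]
  constructor
  · rintro ⟨⟨hb2, ho⟩, hnb1⟩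
    exact ⟨⟨fun h12 => hnb1 (conn_trans hb2 (conn_symm h12)), conn_symm hb2⟩, ho⟩
  · rintro ⟨⟨hQ, hb2⟩, ho⟩
    exact ⟨⟨conn_symm hb2, ho⟩, fun hb1 => hQ (conn_trans (conn_symm hb1) (conn_symm hb2))⟩

omit [Fintype E] [DecidableEq E] [Fintype V] [DecidableEq V] [LinearOrder R] [IsStrictOrderedRing R] in
/-- The second `X̂`-atom: `{b ↔ a₁, a₂ ↔ o, b ↮ a₂} = Q ∩ {b ∈ C₁} ∩ {o ∈ C₂}`. -/
lemma atom_bL_oH (a₁ a₂ o : V) :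
    connEvent ends b a₁ ∩ connEvent ends a₂ o ∩ (connEvent ends b a₂)ᶜ =
      avoidAll ends a₂ {a₁} ∩ connEvent ends a₁ b ∩ connEvent ends a₂ o := by
  rw [avoidAll_eq_compl]
  ext ω
  simp only [Set.mem_inter_iff, Set.mem_compl_iff, connEvent, Set.mem_setOf_eq]
  constructor
  · rintro ⟨⟨hb1, ho⟩, hnb2⟩
    exact ⟨⟨fun h12 => hnb2 (conn_trans hb1 h12), conn_symm hb1⟩, ho⟩
  · rintro ⟨⟨hQ, hb1⟩, ho⟩
    exact ⟨⟨conn_symm hb1, ho⟩, fun hb2 => hQ (conn_trans hb1 hb2)⟩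

omit [Fintype E] [DecidableEq E] [Fintype V] [DecidableEq V] [LinearOrder R] [IsStrictOrderedRing R] in
/-- `b` cannot be in both root clusters under `Q`. -/
lemma Q_bH_bL_empty (a₁ a₂ : V) :
    avoidAll ends a₂ {a₁} ∩ connEvent ends a₂ b ∩ connEvent ends a₁ b = ∅ := by
  rw [avoidAll_eq_compl]
  ext ω
  simp only [Set.mem_inter_iff, Set.mem_compl_iff, connEvent, Set.mem_setOf_eq, Set.mem_empty_iff_false,
    iff_false, not_and]
  rintro ⟨hQ, hb2⟩ hb1
  exact hQ (conn_trans hb1 (conn_symm hb2))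

omit [Fintype E] [DecidableEq E] [Fintype V] [DecidableEq V] [LinearOrder R] [IsStrictOrderedRing R] in
/-- `bN` excludes `b ∈ C₂`. -/
lemma Q_bN_bH_empty (a₁ a₂ : V) :
    avoidAll ends a₂ {a₁} ∩ bN ends a₁ a₂ b ∩ connEvent ends a₂ b = ∅ := by
  ext ω
  simp only [Set.mem_inter_iff, bN, Set.mem_compl_iff, Set.mem_empty_iff_false, iff_false, not_and]
  intro h hb
  exact h.2.2 hb

omit [Fintype E] [DecidableEq E] [Fintype V] [DecidableEq V] [LinearOrder R] [IsStrictOrderedRing R] in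
/-- `bN` excludes `b ∈ C₁`. -/
lemma Q_bN_bL_empty (a₁ a₂ : V) :
    avoidAll ends a₂ {a₁} ∩ bN ends a₁ a₂ b ∩ connEvent ends a₁ b = ∅ := by
  ext ω
  simp only [Set.mem_inter_iff, bN, Set.mem_compl_iff, Set.mem_empty_iff_false, iff_false, not_and]
  intro h hb
  exact h.2.1 hb

omit [Fintype E] [DecidableEq E] [Fintype V] [DecidableEq V] [LinearOrder R] [IsStrictOrderedRing R] in
/-- The diagonal events: `PD(a₃ := b) = Q ∩ bN`. -/
lemma PDEvent_diag (a₁ a₂ : V) : PDEvent ends a₁ a₂ b = avoidAll ends a₂ {a₁} ∩ bN ends a₁ a₂ b := by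
  unfold PDEvent Dtilde inU bN
  rw [avoidAll_eq_compl, connEvent_comm ends b a₁, connEvent_comm ends b a₂, Set.compl_union]

omit [Fintype E] [DecidableEq E] [Fintype V] [DecidableEq V] [LinearOrder R] [IsStrictOrderedRing R] in
/-- The diagonal events: `T(a₃ := b) = Q ∩ {b ∈ C₂}`. -/
lemma TEvent_diag (a₁ a₂ : V) : TEvent ends a₁ a₂ b = avoidAll ends a₂ {a₁} ∩ connEvent ends a₂ b := by
  unfold TEvent
  rw [avoidAll_eq_compl, connEvent_comm ends a₂ a₁]

omit [Fintype E] [DecidableEq E] [Fintype V] [DecidableEq V] [LinearOrder R] [IsStrictOrderedRing R] in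
/-- The diagonal events: `T′(a₃ := b) = Q ∩ {b ∈ C₁}`. -/
lemma TEvent'_diag (a₁ a₂ : V) : TEvent ends a₂ a₁ b = avoidAll ends a₂ {a₁} ∩ connEvent ends a₁ b := by
  unfold TEvent
  rw [avoidAll_eq_compl]

/-- **(ATT-b)**, the first-order attachment functional at `b` (NIGHT1-G6.md §9):
`(Z + B_L) s_LH + (Z + B_H) s_HL − B_H s_LL − B_L s_HH` in the four BHK slacks of the `a₃`-free `Q`-law. -/
noncomputable def attB (o a₁ a₂ b : V) : R :=
  let Z := prob p (avoidAll ends a₂ {a₁})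
  let AL := prob p (avoidAll ends a₂ {a₁} ∩ connEvent ends a₁ o)
  let AH := prob p (avoidAll ends a₂ {a₁} ∩ connEvent ends a₂ o)
  let BL := prob p (avoidAll ends a₂ {a₁} ∩ connEvent ends a₁ b)
  let BH := prob p (avoidAll ends a₂ {a₁} ∩ connEvent ends a₂ b)
  let xLL := prob p (avoidAll ends a₂ {a₁} ∩ connEvent ends a₁ b ∩ connEvent ends a₁ o)
  let xLH := prob p (avoidAll ends a₂ {a₁} ∩ connEvent ends a₂ b ∩ connEvent ends a₁ o)
  let xHL := prob p (avoidAll ends a₂ {a₁} ∩ connEvent ends a₁ b ∩ connEvent ends a₂ o)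
  let xHH := prob p (avoidAll ends a₂ {a₁} ∩ connEvent ends a₂ b ∩ connEvent ends a₂ o)
  (Z + BL) * (AL * BH - Z * xLH) + (Z + BH) * (AH * BL - Z * xHL) -
    BH * (Z * xLL - AL * BL) - BL * (Z * xHH - AH * BH)

end Main

/-! ## The identity `HMFc = 2q(1−q)·attB + q²·Gc(a₃ := b)` and the reduction -/

section Reduction

variable (p : E → R) (ends : E → Sym2 V) {f : E} {a₃ b : V}

omit [Fintype E] [DecidableEq E] [Fintype V] [DecidableEq V] [LinearOrder R] [IsStrictOrderedRing R] in
/-- Absorption: `A ∩ B ∩ (Y ∩ B) = A ∩ B ∩ Y`. -/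
lemma inter_absorb (A B Y : Set (Config E)) : A ∩ B ∩ (Y ∩ B) = A ∩ B ∩ Y := by
  ext ω; simp only [Set.mem_inter_iff]; tauto

omit [Fintype E] [DecidableEq E] [Fintype V] [DecidableEq V] [LinearOrder R] [IsStrictOrderedRing R] in
/-- Emptiness propagates: `A ∩ B ∩ C = ∅ → A ∩ B ∩ (Y ∩ C) = ∅`. -/
lemma inter_empty_of (A B C Y : Set (Config E)) (h : A ∩ B ∩ C = ∅) : A ∩ B ∩ (Y ∩ C) = ∅ := by
  ext ω
  simp only [Set.mem_inter_iff, Set.mem_empty_iff_false, iff_false, not_and]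
  intro hAB _ hC
  have : ω ∈ A ∩ B ∩ C := ⟨hAB, hC⟩
  rw [h] at this
  exact this

omit [Fintype E] [DecidableEq E] [Fintype V] [DecidableEq V] [LinearOrder R] [IsStrictOrderedRing R] in
/-- `A ∩ B ∩ B = A ∩ B`. -/
lemma inter_self_right (A B : Set (Config E)) : A ∩ B ∩ B = A ∩ B := by
  rw [Set.inter_assoc, Set.inter_self]

omit [Fintype E] [DecidableEq E] [Fintype V] [DecidableEq V] [LinearOrder R] [IsStrictOrderedRing R] in
/-- Reorder a two-mark atom: `Q ∩ (X ∩ Y) = Q ∩ Y ∩ X`. -/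
lemma swap_atom (Q X Y : Set (Config E)) : Q ∩ (X ∩ Y) = Q ∩ Y ∩ X := by
  rw [Set.inter_comm X Y, Set.inter_assoc]

omit [Fintype E] [DecidableEq E] [Fintype V] [DecidableEq V] [LinearOrder R] [IsStrictOrderedRing R] in
/-- `b` cannot be in both root clusters under `Q` (the other order). -/
lemma Q_bL_bH_empty (a₁ a₂ : V) :
    avoidAll ends a₂ {a₁} ∩ connEvent ends a₁ b ∩ connEvent ends a₂ b = ∅ := by
  rw [Set.inter_assoc, Set.inter_comm (connEvent ends a₁ b), ← Set.inter_assoc]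
  exact Q_bH_bL_empty ends a₁ a₂

omit [Fintype V] [DecidableEq V] [LinearOrder R] [IsStrictOrderedRing R] in
/-- `P(PD) = (1 − q) P(Q) + q P(Q ∩ bN)`. -/
lemma prob_PD_b (hf : ends f = s(a₃, b)) (hleaf : ∀ e, a₃ ∈ ends e → e = f) (h3b : a₃ ≠ b)
    {a₁ a₂ : V} (h31 : a₃ ≠ a₁) (h32 : a₃ ≠ a₂) :
    prob p (PDEvent ends a₁ a₂ a₃) =
      (1 - p f) * prob p (avoidAll ends a₂ {a₁}) +
        p f * prob p (avoidAll ends a₂ {a₁} ∩ bN ends a₁ a₂ b) := by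
  have h := prob_PD_inter_b p hf hleaf h3b h31 h32 (X := Set.univ) (fun _ _ _ => rfl)
  simpa only [Set.inter_univ] using h

omit [Fintype V] [DecidableEq V] [LinearOrder R] [IsStrictOrderedRing R] in
/-- `P(T) = q P(Q ∩ {b ∈ C₂})`. -/
lemma prob_T_b (hf : ends f = s(a₃, b)) (hleaf : ∀ e, a₃ ∈ ends e → e = f) (h3b : a₃ ≠ b)
    {a₁ a₂ : V} (h31 : a₃ ≠ a₁) (h32 : a₃ ≠ a₂) :
    prob p (TEvent ends a₁ a₂ a₃) = p f * prob p (avoidAll ends a₂ {a₁} ∩ connEvent ends a₂ b) := by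
  have h := prob_T_inter_b p hf hleaf h3b h31 h32 (X := Set.univ) (fun _ _ _ => rfl)
  simpa only [Set.inter_univ] using h

omit [Fintype V] [DecidableEq V] [LinearOrder R] [IsStrictOrderedRing R] in
/-- `P(T′) = q P(Q ∩ {b ∈ C₁})`. -/
lemma prob_T'_b (hf : ends f = s(a₃, b)) (hleaf : ∀ e, a₃ ∈ ends e → e = f) (h3b : a₃ ≠ b)
    {a₁ a₂ : V} (h31 : a₃ ≠ a₁) (h32 : a₃ ≠ a₂) :
    prob p (TEvent ends a₂ a₁ a₃) = p f * prob p (avoidAll ends a₂ {a₁} ∩ connEvent ends a₁ b) := by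
  have h := prob_T'_inter_b p hf hleaf h3b h31 h32 (X := Set.univ) (fun _ _ _ => rfl)
  simpa only [Set.inter_univ] using h

omit [Fintype V] [DecidableEq V] [LinearOrder R] [IsStrictOrderedRing R] in
/-- Under `Q`, `b` is in `C₁`, in `C₂`, or in neither: `P(Q ∩ bN ∩ X) = P(Q ∩ X) − P(Q ∩ bL ∩ X) − P(Q ∩ bH ∩ X)`. -/
lemma prob_bN_split (a₁ a₂ : V) (X : Set (Config E)) :
    prob p (avoidAll ends a₂ {a₁} ∩ bN ends a₁ a₂ b ∩ X) =
      prob p (avoidAll ends a₂ {a₁} ∩ X) -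
        prob p (avoidAll ends a₂ {a₁} ∩ connEvent ends a₁ b ∩ X) -
        prob p (avoidAll ends a₂ {a₁} ∩ connEvent ends a₂ b ∩ X) := by
  have h1 := prob_inter_add_prob_inter_compl p (avoidAll ends a₂ {a₁} ∩ X) (connEvent ends a₁ b)
  have h2 := prob_inter_add_prob_inter_compl p (avoidAll ends a₂ {a₁} ∩ X ∩ (connEvent ends a₁ b)ᶜ)
    (connEvent ends a₂ b)
  have e1 : avoidAll ends a₂ {a₁} ∩ X ∩ connEvent ends a₁ b =
      avoidAll ends a₂ {a₁} ∩ connEvent ends a₁ b ∩ X := by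
    rw [Set.inter_assoc, Set.inter_comm X, ← Set.inter_assoc]
  have e2 : avoidAll ends a₂ {a₁} ∩ X ∩ (connEvent ends a₁ b)ᶜ ∩ connEvent ends a₂ b =
      avoidAll ends a₂ {a₁} ∩ connEvent ends a₂ b ∩ X := by
    rw [avoidAll_eq_compl]
    ext ω
    simp only [Set.mem_inter_iff, Set.mem_compl_iff, connEvent, Set.mem_setOf_eq]
    constructor
    · rintro ⟨⟨⟨hQ, hx⟩, _⟩, hb2⟩; exact ⟨⟨hQ, hb2⟩, hx⟩
    · rintro ⟨⟨hQ, hb2⟩, hx⟩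
      exact ⟨⟨⟨hQ, hx⟩, fun hb1 => hQ (conn_trans hb1 (conn_symm hb2))⟩, hb2⟩
  have e3 : avoidAll ends a₂ {a₁} ∩ X ∩ (connEvent ends a₁ b)ᶜ ∩ (connEvent ends a₂ b)ᶜ =
      avoidAll ends a₂ {a₁} ∩ bN ends a₁ a₂ b ∩ X := by
    ext ω; simp only [Set.mem_inter_iff, bN, Set.mem_compl_iff]; tauto
  rw [e1] at h1
  rw [e2, e3] at h2
  linear_combination h1 + h2

/-- **The mean-field identity at a pendant `b`** (NIGHT1-G6.md §9):
`HMFc = 2 q (1 − q) · attB + q² · Gc(o, a₁, a₂, b, b)`. -/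
theorem HMFc_pendant_b (hp : IsProbVec p) (hf : ends f = s(a₃, b))
    (hleaf : ∀ e, a₃ ∈ ends e → e = f) (h3b : a₃ ≠ b) {o a₁ a₂ : V} (h31 : a₃ ≠ a₁) (h32 : a₃ ≠ a₂)
    (ho : o ≠ a₃) :
    HMFc p ends o a₁ a₂ a₃ b =
      2 * p f * (1 - p f) * attB p ends o a₁ a₂ b + p f ^ 2 * Gc p ends o a₁ a₂ b b := by
  have h13 : a₁ ≠ a₃ := Ne.symm h31
  have h23 : a₂ ≠ a₃ := Ne.symm h32
  have hb3 : b ≠ a₃ := Ne.symm h3b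
  have c₁o := free_connEvent hf hleaf h3b h13 ho
  have c₂o := free_connEvent hf hleaf h3b h23 ho
  have c₁b := free_connEvent hf hleaf h3b h13 hb3
  have c₂b := free_connEvent hf hleaf h3b h23 hb3
  have cQ := free_avoidAll_b hf hleaf h3b h31 h32
  have ht := termW_leaf_b p ends hp hf hleaf h3b h31 h32 ho
  have hX := Xhat_pendant_b p ends hf hleaf h3b o a₁ a₂
  rw [b_sum_eq p ends hf o a₁ a₂, expect_Fb p ends o a₁ a₂, atom_bH_oL, atom_bL_oH,
    prob_update_one_of_free p ((cQ.inter c₂b).inter c₁o),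
    prob_update_one_of_free p ((cQ.inter c₁b).inter c₂o)] at hX
  -- the empty and absorbed atoms
  have eHL := Q_bH_bL_empty (ends := ends) (b := b) a₁ a₂
  have eLH := Q_bL_bH_empty (ends := ends) (b := b) a₁ a₂
  have eNH := Q_bN_bH_empty (ends := ends) (b := b) a₁ a₂
  have eNL := Q_bN_bL_empty (ends := ends) (b := b) a₁ a₂
  unfold HMFc marginC DEF EQo EQ3 EQ3o Do massM2 deltaT
  rw [gap_eq_Q, hX, Set.inter_comm (connEvent ends a₂ b) (TEvent ends a₁ a₂ a₃),
    Set.inter_comm (connEvent ends a₁ b) (TEvent ends a₁ a₂ a₃)]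
  simp only [prob_PD_inter_b p hf hleaf h3b h31 h32 c₁o, prob_PD_inter_b p hf hleaf h3b h31 h32 c₂o,
    prob_PD_inter_b p hf hleaf h3b h31 h32 c₂b,
    prob_T_inter_b p hf hleaf h3b h31 h32 c₁o, prob_T_inter_b p hf hleaf h3b h31 h32 c₂o,
    prob_T_inter_b p hf hleaf h3b h31 h32 c₁b, prob_T_inter_b p hf hleaf h3b h31 h32 c₂b,
    prob_T'_inter_b p hf hleaf h3b h31 h32 c₁o, prob_T'_inter_b p hf hleaf h3b h31 h32 c₂o,
    prob_PD_b p ends hf hleaf h3b h31 h32, prob_T_b p ends hf hleaf h3b h31 h32,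
    prob_T'_b p ends hf hleaf h3b h31 h32,
    eHL, eNH, prob_empty]
  simp only [inter_self_right]
  -- the diagonal `Gc(a₃ := b)` in the same atoms
  unfold Gc DEF EQbo EQb3 EQb3o EQo EQ3 EQ3o PDb PDbo Do
  rw [gap_eq_Q, PDEvent_diag ends a₁ a₂, TEvent_diag ends a₁ a₂, TEvent'_diag ends a₁ a₂]
  simp only [swap_atom (avoidAll ends a₂ {a₁}) (connEvent ends a₁ o) (connEvent ends a₁ b),
    swap_atom (avoidAll ends a₂ {a₁}) (connEvent ends a₂ o) (connEvent ends a₂ b),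
    swap_atom (avoidAll ends a₂ {a₁}) (connEvent ends a₂ o) (connEvent ends a₁ b),
    swap_atom (avoidAll ends a₂ {a₁}) (connEvent ends a₁ o) (connEvent ends a₂ b),
    inter_absorb, inter_empty_of _ _ _ _ eHL, inter_empty_of _ _ _ _ eLH,
    inter_empty_of _ _ _ _ eNH, inter_empty_of _ _ _ _ eNL, eHL, eLH, eNH, eNL, prob_empty,
    inter_self_right]
  unfold attB
  have s1 := prob_bN_split p ends (b := b) a₁ a₂ (connEvent ends a₁ o)
  have s2 := prob_bN_split p ends (b := b) a₁ a₂ (connEvent ends a₂ o)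
  have s3 := prob_bN_split p ends (b := b) a₁ a₂ Set.univ
  simp only [Set.inter_univ] at s3
  rw [s1, s2, s3]
  linear_combination (-2 * (1 - p f) * (prob p (avoidAll ends a₂ {a₁}) -
    p f * (prob p (avoidAll ends a₂ {a₁} ∩ connEvent ends a₁ b) +
      prob p (avoidAll ends a₂ {a₁} ∩ connEvent ends a₂ b)))) * ht

/-- **(ATT-b) ⟹ (HMF) at a pendant `a₃` at `b`** (hence (HCOV) there, the cell's open attachment case):
the mean field at a pendant `b` is `2q(1−q)·attB + q²·Gc(a₃ := b)`, the diagonal is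
`DiagBA3.Gc_diag3_nonneg`, and (ATT-b) is the first-order attachment inequality. -/
theorem HMF_pendant_b (hp : IsProbVec p) (hf : ends f = s(a₃, b))
    (hleaf : ∀ e, a₃ ∈ ends e → e = f) (h3b : a₃ ≠ b) {o a₁ a₂ : V} (h31 : a₃ ≠ a₁) (h32 : a₃ ≠ a₂)
    (ho : o ≠ a₃) (hATT : 0 ≤ attB p ends o a₁ a₂ b) : HMF p ends o a₁ a₂ a₃ b := by
  unfold HMF
  rw [HMFc_pendant_b p ends hp hf hleaf h3b h31 h32 ho]
  have hq0 := hp.nonneg f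
  have hq1 := sub_nonneg.2 (hp.le_one f)
  have hG := DiagBA3.Gc_diag3_nonneg p hp ends o a₁ a₂ b
  exact add_nonneg (mul_nonneg (mul_nonneg (mul_nonneg (by norm_num) hq0) hq1) hATT)
    (mul_nonneg (sq_nonneg _) hG)

/-- **(ATT-b) ⟹ (HCOV) at a pendant `a₃` at `b`** (via `HCov_of_HMF`). -/
theorem HCov_pendant_b (hp : IsProbVec p) (hf : ends f = s(a₃, b))
    (hleaf : ∀ e, a₃ ∈ ends e → e = f) (h3b : a₃ ≠ b) {o a₁ a₂ : V} (h31 : a₃ ≠ a₁) (h32 : a₃ ≠ a₂)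
    (ho : o ≠ a₃) (hATT : 0 ≤ attB p ends o a₁ a₂ b) : HCov p ends o a₁ a₂ a₃ b :=
  HCov_of_HMF p hp ends o a₁ a₂ a₃ b (HMF_pendant_b p ends hp hf hleaf h3b h31 h32 ho hATT)

end Reduction

end HMFPendantB

end Summit.Ventures.PercRepro2
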